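import Mathlib
import Literature.MathematicalPhysics.QuantumFieldTheory.Balaban1983to89.B5Prop11Fiber

/-!
# B5, Proposition 1.1 / (1.89): the Plancherel step in the kernel — from the fiber bounds of
`B5Prop11Fiber` to the six operator-norm bounds on `ℓ²(T_η; ℂ^d)`

Source under audit (cell `pub-balaban`, node T02.1, SHARPEN pass 4; value = kernel certificate
of a FOLKLORE step (finite-torus Plancherel + Fourier multipliers + block decomposition over the
cosets `p = p′ + l`), NOT summit progress):
T. Bałaban, *Propagators and renormalization transformations for lattice gauge theories. I*,
Commun. Math. Phys. **95** (1984) 17–40 (`Balaban1984PropagatorsI`, "B5"). Page numbers are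
journal pages; quotations are read off the rendered PDF (cell folder
`b2b-balaban-ref1/pages/1984-cmp95-propagators-rt-I/`, PDF page = journal page − 16).

## What the paper prints (verbatim)

* p. 23, (1.29): "The momentum representation on an arbitrary torus
  T′_η = {x ∈ ηZ^d : −L′_μ ≤ x_μ < L′_μ, μ = 1, …, d} is introduced by the Fourier transform
  f̃(p) = Σ_{x∈T′_η} η^d e^{−ip·x} f(x), p ∈ T̃′_η,
  f(x) = (2π)^{−d} Σ_{p∈T̃′_η} (Π_{μ=1}^{d} π/L′_μ) e^{ix·p} f̃(p),  (1.29)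
  where T̃′_η is a dual torus T̃′_η = {p = (p₁, …, p_d): p_μ = (π/L′_μ)n_μ, n_μ is an integer,
  −L′_μη^{−1} ≤ n_μ < L′_μη^{−1}, μ = 1, …, d}."
* p. 23, (1.31) and after: "Δ(p) = Σ_{μ=1}^{d} |∂_μ(p)|²,  ∂_μ(p) = (e^{iηp_μ} − 1)/η, … (1.31)
  where p′ belongs to a dual torus T̃₁^{(k)} = {p′ = (p′₁, …, p′_d): p′_μ = (π/L_μ)L^kε n_μ,
  n_μ is an integer, −L_μ/L^kε ≤ n_μ < L_μ/L^kε, μ = 1, …, d},  p ∈ T̃_η is represented as a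
  sum p = p′ + l, p′ ∈ T̃₁^{(k)} and l = (l₁, …, l_d), l_μ = 2πm_μ, m_μ is an integer,
  −(L^k − 1)/2 ≤ m_μ ≤ (L^k − 1)/2 for L odd, −L^k/2 ≤ m_μ < L^k/2 for L even."
* p. 31, before and after (1.83): "This gives the solution of Eq. (1.73), so G = Δ_a^{−1}. To
  investigate better the operator G we write it in momentum representation:
  Ã_μ(p′ + l) = (GJ)~_μ(p′ + l) = …   (1.83)
  for p′ ≠ 0, Ã_μ(l) = (1/Δ(l)) J̃_μ(l), Ã_μ(0) = a^{−1} J̃_μ(0), where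
  φ_μ(p′) = 1 + a Σ_{l″} |u(p′ + l″)|²|v_μ(p′ + l″)|²/Δ(p′ + l″)  for p′ ≠ 0.  (1.84)"
  (the matrix of (1.83) is typed, entry by entry, in `B5Prop11Bound` / `B5Prop11Fiber`).
* p. 32, l. 17–20: "Using all the properties of the functions appearing above, e.g. the
  inequality (1.36), we can easily prove that this expression defines a bounded operator on
  L²(T_η). It is bounded also when differentiated two times at most."
* p. 33, Proposition 1.1: "The operator G is a symmetric operator on L²(T_η) and
  ‖GJ‖, ‖∇GJ‖, ‖G∇*J‖, ‖∇G∇*J‖, ‖∇∇GJ‖, ‖G∇*∇*J‖ ≤ γ₀^{−1}‖J‖,   (1.89)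
  with a positive constant γ₀ independent of k, T_η, and depending on d only (if we put a = 1)."

## What is certified here (kernel; 0 sorry; no axioms beyond Mathlib's)

The folklore step the paper does not write — "a translation-covariant operator given by a
family of matrices over the cosets `p = p′ + l` is bounded on `L²` by the supremum of the matrix
norms, and `∇`, `∇*` act there as the diagonal weights `∂_ν(p′+l)`, `conj ∂_ν(p′+l)`" — for
the finite torus, in Mathlib's `ℓ² → ℓ²` operator norm (`Matrix.instL2OpNormedRing`):

* §1 (`opNorm_reindex`, `opNorm_blockDiagonal_le`, `opNorm_le_opNorm_blockDiagonal`,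
  `opNorm_unitary_conj`, `opNorm_le_of_blocks`): reindexing and unitary conjugation preserve
  the operator norm; a block-diagonal family has norm `≤ C` iff every block has; hence
  `‖T‖ ≤ C` as soon as `U T U^*` is, along SOME re-indexing, block-diagonal with blocks `≤ C`.
* §2 (`dft`, `dft_mul_star`, `dft_mem_unitaryGroup`): the discrete Fourier transform
  `F_{p,x} = |T|^{−1/2} e^{−ip·x}` of the finite torus `Π_μ ℤ/N_μ` (any sizes `N_μ ≥ 1`) is
  UNITARY — Plancherel; proved from the orthogonality of the characters
  (`AddChar.sum_mulShift`, `ZMod.isPrimitive_stdAddChar`).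
* §3 (`dftV`, `fdiff`, `fsym`, `dftV_mul_fdiff`, `fdiff_eq`, `star_fdiff_eq`): on vector fields
  `J : T_η → ℂ^d` (index `Tor N × Fin d`) the componentwise DFT is unitary, and the forward
  difference `(∇_ν J)_μ(x) = η^{−1}(J_μ(x + ηe_ν) − J_μ(x))` and its adjoint are the Fourier
  multipliers with symbols `η^{−1}(e^{iηp_ν} − 1)` and its conjugate — EXACTLY `∂_ν(p)` of (1.31).
* §4 (`emb`, `blockEquiv`, `sOf`, `abs_sOf_le`, `sOf_ne_zero`, `fsym_emb`): with `N_μ = n·M_μ`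
  fine sites (`n = η^{−1}`; `M_μ` unit-lattice sites) the decomposition `p = p′ + l` is the
  bijection `j_μ = v(q_μ) + M_μ k_μ (mod nM_μ)` between fine momenta `j` and pairs
  (coarse class `q ∈ Π ℤ/M_μ` with centred representative `v`, offset `k ∈ (Fin n)^d`); the
  reduced momentum `p′_ν = 2πv(q_ν)/M_ν` lies in `[−π, π]`, vanishes iff `q = 0`, and ON THE
  COSET the symbol of `∇_ν` IS `B5Prop11Fiber.dSym n k p′ ν = ∂_ν(p′ + l)`, `l = 2πk`.
* §5: `calG` — THE operator on `ℓ²(T_η; ℂ^d)` whose Fourier blocks over the cosets are the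
  matrices (1.83) (`B5Prop11Fiber.balabanFiber … .G` at `p′ ≠ 0`) and the printed `p′ = 0`
  values "Ã_μ(l) = Δ(l)^{−1} J̃_μ(l), Ã_μ(0) = a^{−1} J̃_μ(0)" (`B5Prop11Bound.G₀`) — is
  Hermitian (`calG_isHermitian`: "G is a symmetric operator"), and for every `d`, `n ≥ 1`,
  `M_μ ≥ 1`, `a > 0` and all directions `ν, ν′`:
  `‖𝒢‖, ‖∇_ν 𝒢‖, ‖𝒢 ∇_ν^*‖, ‖∇_ν 𝒢 ∇_{ν′}^*‖, ‖∇_ν ∇_{ν′} 𝒢‖, ‖𝒢 ∇_ν^* ∇_{ν′}^*‖ ≤ Cst d a`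
  (`opNorm_calG_le`, `opNorm_fdiff_calG_le`, `opNorm_calG_star_fdiff_le`,
  `opNorm_fdiff_calG_star_fdiff_le`, `opNorm_fdiff_fdiff_calG_le`,
  `opNorm_calG_star_fdiff_star_fdiff_le`) with `Cst d a = max (gamma0 d a) (max a⁻¹ 1)` — a
  constant depending on `d` and `a` ONLY, uniform in `η = 1/n` and in the torus (`M`): the
  printed "independent of k, T_η, and depending on d only (if we put a = 1)", with OUR constant.
  The reduction (`opNorm_mulW_le`, `reindex_conj_mulW`, `block_bound_of_orders`) is: conjugate
  by the DFT, re-index along the cosets, read off the block `D_{w₁} G(p′) D_{w₂}^*`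
  (`B5Prop11Bound.sandwich`) and apply `B5Prop11Fiber.opNorm_sandwich_G_le_of_orders`
  (`p′ ≠ 0`) / `B5Prop11Bound.opNorm_sandwich_G₀_le` (`p′ = 0`, where every weight of positive
  order vanishes at `l = 0` because `Δ(0) = 0`).

Normalisations: B5's transform (1.29) is `c·F` for a positive constant `c` (the factors `η^d`,
`(2π)^{−d} Π π/L′_μ`), and `(cF)^{−1} X (cF) = F^{−1} X F`, so `calG` IS the operator with the
given momentum-space blocks in B5's convention, not merely one with the same norm.

## What is NOT certified here

(1) that (1.83) is the momentum representation of `G = Δ_a^{−1}` defined through (1.71)–(1.82)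
— the printed computation pp. 29–31 is not formalised; `calG` is DEFINED by its blocks;
(2) the gradient-form norms of (1.89) (`∇` = the vector of all `∇_ν`): they follow from the
componentwise bounds above with an extra factor `√d` resp. `d`, still depending on `d` only —
elementary, not typed; (3) (1.90); (4) no value of `γ₀` is attributed to the paper; (5) the
torus sizes are arbitrary `n ≥ 1`, `M_μ ≥ 1` (B5's are `n = L^k`, `M_μ = 2L_μ/(L^kε)`); the
centred representative `v ∈ (−M_μ/2, M_μ/2]` (Mathlib's `ZMod.valMinAbs`) replaces the printed
`−M_μ/2 ≤ n_μ < M_μ/2` and `k ∈ (Fin n)^d` the printed symmetric `m_μ`-range — immaterial, all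
symbols being `2π`-periodic in `p_μ = p′_μ + l_μ` (recorded in the cell's DIVERGENCE.md).
-/

open scoped BigOperators Matrix ComplexConjugate Matrix.Norms.L2Operator
open Finset Complex

namespace Literature.MathematicalPhysics.QuantumFieldTheory.Balaban1983to89.B5Prop11Plancherel

open Literature.MathematicalPhysics.QuantumFieldTheory.Balaban1983to89.B4Strip
open Literature.MathematicalPhysics.QuantumFieldTheory.Balaban1983to89.B5Prop11Leaves
open Literature.MathematicalPhysics.QuantumFieldTheory.Balaban1983to89.B5Prop11Bound
open Literature.MathematicalPhysics.QuantumFieldTheory.Balaban1983to89.B5Prop11Fiber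

noncomputable section

/-! ## §1. `ℓ²`-operator-norm tools: reindexing, block-diagonal families, unitary conjugation -/

section OpNorm

variable {m m' o : Type*} [Fintype m] [DecidableEq m] [Fintype m'] [DecidableEq m']
  [Fintype o] [DecidableEq o]

/-- `Σ_i |Σ_j X_ij x_j|² ≤ ‖X‖² Σ_j |x_j|²` (the operator norm bounds the action on every vector).
[folklore] -/
theorem sq_norm_apply_le (X : Matrix m m ℂ) (x : m → ℂ) :
    ∑ i, ‖∑ j, X i j * x j‖ ^ 2 ≤ ‖X‖ ^ 2 * ∑ j, ‖x j‖ ^ 2 := by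
  let ψ : EuclideanSpace ℂ m := WithLp.toLp 2 x
  have h := MatrixNorms.norm_apply_le_opNorm_mul X ψ
  have h1 : ‖Matrix.toEuclideanCLM (n := m) (𝕜 := ℂ) X ψ‖ ^ 2 = ∑ i, ‖∑ j, X i j * x j‖ ^ 2 := by
    rw [EuclideanSpace.norm_sq_eq]
    refine Finset.sum_congr rfl fun i _ => ?_
    rw [toEuclideanCLM_apply]
  have h2 : ‖ψ‖ ^ 2 = ∑ j, ‖x j‖ ^ 2 := by
    rw [EuclideanSpace.norm_sq_eq]
  rw [← h1, ← h2, ← mul_pow]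
  exact pow_le_pow_left₀ (norm_nonneg _) h 2

/-- operator-norm bound from a quadratic bound on coordinates: if
`Σ_i |Σ_j X_ij x_j|² ≤ C² Σ_j |x_j|²` for all `x` then `‖X‖ ≤ C`. [folklore] -/
theorem opNorm_le_of_sq_le (X : Matrix m m ℂ) {C : ℝ} (hC : 0 ≤ C)
    (h : ∀ x : m → ℂ, ∑ i, ‖∑ j, X i j * x j‖ ^ 2 ≤ C ^ 2 * ∑ j, ‖x j‖ ^ 2) : ‖X‖ ≤ C := by
  refine MatrixNorms.opNorm_le_of_bound X hC fun ψ => ?_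
  have h1 : ‖Matrix.toEuclideanCLM (n := m) (𝕜 := ℂ) X ψ‖ ^ 2 = ∑ i, ‖∑ j, X i j * ψ j‖ ^ 2 := by
    rw [EuclideanSpace.norm_sq_eq]
    refine Finset.sum_congr rfl fun i _ => ?_
    rw [toEuclideanCLM_apply]
  have h2 : ‖ψ‖ ^ 2 = ∑ j, ‖ψ j‖ ^ 2 := EuclideanSpace.norm_sq_eq ψ
  have h3 := h (fun j => ψ j)
  rw [← h1, ← h2, ← mul_pow] at h3
  exact (pow_le_pow_iff_left₀ (norm_nonneg _) (mul_nonneg hC (norm_nonneg _)) two_ne_zero).mp h3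

/-- reindexing both indices along an equivalence does not change the operator norm (`≤`).
[folklore] -/
theorem opNorm_reindex_le (e : m ≃ m') (A : Matrix m m ℂ) :
    ‖Matrix.reindex e e A‖ ≤ ‖A‖ := by
  refine opNorm_le_of_sq_le _ (norm_nonneg A) fun x => ?_
  have h := sq_norm_apply_le A (fun j => x (e j))
  have h1 : ∑ i, ‖∑ j, (Matrix.reindex e e A) i j * x j‖ ^ 2
      = ∑ i, ‖∑ j, A i j * x (e j)‖ ^ 2 := by
    rw [← e.sum_comp]
    refine Finset.sum_congr rfl fun i _ => ?_
    rw [← e.sum_comp]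
    simp only [Matrix.reindex_apply, Matrix.submatrix_apply, Equiv.symm_apply_apply]
  have h2 : ∑ j, ‖x j‖ ^ 2 = ∑ j, ‖x (e j)‖ ^ 2 := by
    rw [← e.sum_comp]
  rw [h1, h2]
  exact h

/-- `‖reindex e e A‖ = ‖A‖`. [folklore] -/
theorem opNorm_reindex (e : m ≃ m') (A : Matrix m m ℂ) : ‖Matrix.reindex e e A‖ = ‖A‖ := by
  refine le_antisymm (opNorm_reindex_le e A) ?_
  have h := opNorm_reindex_le e.symm (Matrix.reindex e e A)
  have h1 : Matrix.reindex e.symm e.symm (Matrix.reindex e e A) = A := by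
    ext i j
    simp
  rwa [h1] at h

/-- the operator norm of a block-diagonal family is at most the largest block norm. [folklore] -/
theorem opNorm_blockDiagonal_le (B : o → Matrix m m ℂ) {C : ℝ} (hC : 0 ≤ C)
    (h : ∀ k, ‖B k‖ ≤ C) : ‖Matrix.blockDiagonal B‖ ≤ C := by
  refine opNorm_le_of_sq_le _ hC fun x => ?_
  -- split the index `m × o` as `o`-families of `m`-vectors
  have key : ∀ i : m × o, ∑ j : m × o, Matrix.blockDiagonal B i j * x j
      = ∑ j : m, B i.2 i.1 j * x (j, i.2) := by
    intro i
    rw [Fintype.sum_prod_type_right, Finset.sum_eq_single i.2]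
    · simp [Matrix.blockDiagonal_apply]
    · intro k' _ hk'
      simp [Matrix.blockDiagonal_apply, Ne.symm hk']
    · simp
  have h1 : ∑ i : m × o, ‖∑ j : m × o, Matrix.blockDiagonal B i j * x j‖ ^ 2
      = ∑ k : o, ∑ i : m, ‖∑ j : m, B k i j * x (j, k)‖ ^ 2 := by
    simp_rw [key]
    rw [Fintype.sum_prod_type_right]
  have h2 : ∑ j : m × o, ‖x j‖ ^ 2 = ∑ k : o, ∑ j : m, ‖x (j, k)‖ ^ 2 := by
    rw [Fintype.sum_prod_type_right]
  rw [h1, h2, Finset.mul_sum]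
  refine Finset.sum_le_sum fun k _ => ?_
  have h3 := sq_norm_apply_le (B k) (fun j => x (j, k))
  have h4 : ‖B k‖ ^ 2 ≤ C ^ 2 := pow_le_pow_left₀ (norm_nonneg _) (h k) 2
  exact h3.trans (mul_le_mul_of_nonneg_right h4 (sum_norm_sq_nonneg _))

/-- each block norm is at most the norm of the block-diagonal family. [folklore] -/
theorem opNorm_le_opNorm_blockDiagonal (B : o → Matrix m m ℂ) (k : o) :
    ‖B k‖ ≤ ‖Matrix.blockDiagonal B‖ := by
  refine opNorm_le_of_sq_le _ (norm_nonneg _) fun x => ?_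
  -- embed `x` in the `k`-th block
  let y : m × o → ℂ := fun j => if j.2 = k then x j.1 else 0
  have h := sq_norm_apply_le (Matrix.blockDiagonal B) y
  have h1 : ∑ j : m × o, ‖y j‖ ^ 2 = ∑ j, ‖x j‖ ^ 2 := by
    rw [Fintype.sum_prod_type_right, Finset.sum_eq_single k]
    · simp [y]
    · intro k' _ hk'
      simp [y, hk']
    · simp
  have key : ∀ i : m, ∑ j : m × o, Matrix.blockDiagonal B (i, k) j * y j = ∑ j, B k i j * x j := by
    intro i
    rw [Fintype.sum_prod_type_right, Finset.sum_eq_single k]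
    · simp [y, Matrix.blockDiagonal_apply]
    · intro k' _ hk'
      simp [y, hk', Matrix.blockDiagonal_apply]
    · simp
  have h2 : ∑ i, ‖∑ j, B k i j * x j‖ ^ 2
      ≤ ∑ i : m × o, ‖∑ j : m × o, Matrix.blockDiagonal B i j * y j‖ ^ 2 := by
    rw [Fintype.sum_prod_type_right]
    refine le_trans (le_of_eq ?_) (Finset.single_le_sum (f := fun k' => ∑ i : m,
      ‖∑ j : m × o, Matrix.blockDiagonal B (i, k') j * y j‖ ^ 2)
      (fun _ _ => Finset.sum_nonneg fun _ _ => sq_nonneg _) (Finset.mem_univ k))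
    simp only [key]
  rw [← h1]
  exact h2.trans h

/-- unitary conjugation preserves the operator norm: `‖U A U^*‖ = ‖A‖`. [folklore] -/
theorem opNorm_unitary_conj {U : Matrix m m ℂ} (hU : U ∈ Matrix.unitaryGroup m ℂ)
    (A : Matrix m m ℂ) : ‖U * A * star U‖ = ‖A‖ := by
  rw [CStarRing.norm_mul_mem_unitary _ (Unitary.star_mem hU), CStarRing.norm_mem_unitary_mul _ hU]

/-- `‖U^* A U‖ = ‖A‖`. [folklore] -/
theorem opNorm_unitary_conj' {U : Matrix m m ℂ} (hU : U ∈ Matrix.unitaryGroup m ℂ)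
    (A : Matrix m m ℂ) : ‖star U * A * U‖ = ‖A‖ := by
  rw [CStarRing.norm_mul_mem_unitary _ hU, CStarRing.norm_mem_unitary_mul _ (Unitary.star_mem hU)]

/-- THE ABSTRACT PLANCHEREL BOUND: if `U` is unitary and `U T U^*`, reindexed along ANY
equivalence `m ≃ m' × o`, is block-diagonal with blocks of norm `≤ C`, then `‖T‖ ≤ C`.
[folklore] -/
theorem opNorm_le_of_blocks {U : Matrix m m ℂ} (hU : U ∈ Matrix.unitaryGroup m ℂ)
    (e : m ≃ m' × o) (T : Matrix m m ℂ) (B : o → Matrix m' m' ℂ)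
    (hT : Matrix.reindex e e (U * T * star U) = Matrix.blockDiagonal B) {C : ℝ} (hC : 0 ≤ C)
    (hB : ∀ k, ‖B k‖ ≤ C) : ‖T‖ ≤ C := by
  rw [← opNorm_unitary_conj hU T, ← opNorm_reindex e, hT]
  exact opNorm_blockDiagonal_le B hC hB

end OpNorm

/-! ## §2. The discrete Fourier transform of the finite torus `Π_μ ℤ/N_μ` is unitary -/

section DFT

variable {d : ℕ} (N : Fin d → ℕ) [hN : ∀ μ, NeZero (N μ)]

/-- the sites (and the momentum indices) of the torus `Π_{μ} ℤ/N_μ`; B5's `T_η` has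
`x_μ = η j_μ`, its dual `T̃_η` has `η p_μ = 2π j_μ/N_μ` ((1.29): `N_μ = 2L′_μ/η` sites per
direction). [cite: Balaban1984PropagatorsI, (1.29) p.23] -/
abbrev Tor : Type := (μ : Fin d) → ZMod (N μ)

/-- the character `e^{i p·x} = Π_μ e^{2πi p_μ x_μ / N_μ}`. [folklore] -/
def chi (p x : Tor N) : ℂ := ∏ μ, (ZMod.stdAddChar (N := N μ)) (p μ * x μ)

/-- `|character| = 1` factorwise: `conj ψ(a) = ψ(-a)`. [folklore] -/
theorem conj_stdAddChar {M : ℕ} [NeZero M] (a : ZMod M) :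
    conj ((ZMod.stdAddChar (N := M)) a) = (ZMod.stdAddChar (N := M)) (-a) := by
  rw [ZMod.stdAddChar_apply, ZMod.stdAddChar_apply, AddChar.map_neg_eq_inv, Circle.coe_inv_eq_conj]

/-- `conj e^{ip·x} = e^{i(-p)·x}`. [folklore] -/
theorem conj_chi (p x : Tor N) : conj (chi N p x) = chi N (-p) x := by
  unfold chi
  rw [map_prod]
  refine Finset.prod_congr rfl fun μ _ => ?_
  rw [conj_stdAddChar, Pi.neg_apply, neg_mul]

/-- `e^{ip·x} e^{iq·x} = e^{i(p+q)·x}`. [folklore] -/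
theorem chi_add_left (p q x : Tor N) : chi N (p + q) x = chi N p x * chi N q x := by
  unfold chi
  rw [← Finset.prod_mul_distrib]
  refine Finset.prod_congr rfl fun μ _ => ?_
  rw [Pi.add_apply, add_mul, AddChar.map_add_eq_mul]

/-- `e^{ip·(x+y)} = e^{ip·x} e^{ip·y}`. [folklore] -/
theorem chi_add_right (p x y : Tor N) : chi N p (x + y) = chi N p x * chi N p y := by
  unfold chi
  rw [← Finset.prod_mul_distrib]
  refine Finset.prod_congr rfl fun μ _ => ?_
  rw [Pi.add_apply, mul_add, AddChar.map_add_eq_mul]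

/-- `e^{i0·x} = 1`. [folklore] -/
theorem chi_zero_left (x : Tor N) : chi N 0 x = 1 := by
  unfold chi
  simp

/-- character orthogonality on the torus: `Σ_x e^{ir·x} = |T| δ_{r,0}`. [folklore] -/
theorem sum_chi (r : Tor N) :
    ∑ x : Tor N, chi N r x = if r = 0 then (Fintype.card (Tor N) : ℂ) else 0 := by
  classical
  unfold chi
  rw [← Fintype.prod_sum (fun μ (y : ZMod (N μ)) => (ZMod.stdAddChar (N := N μ)) (r μ * y))]
  have hfac : ∀ μ, ∑ y : ZMod (N μ), (ZMod.stdAddChar (N := N μ)) (r μ * y)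
      = if r μ = 0 then (N μ : ℂ) else 0 := by
    intro μ
    simp_rw [mul_comm (r μ)]
    rw [AddChar.sum_mulShift (r μ) (ZMod.isPrimitive_stdAddChar (N μ)), ZMod.card]
    split_ifs <;> simp
  simp_rw [hfac]
  split_ifs with hr
  · subst hr
    simp only [Pi.zero_apply, if_true]
    rw [Fintype.card_pi]
    push_cast
    simp only [ZMod.card]
  · obtain ⟨μ, hμ⟩ : ∃ μ, r μ ≠ 0 := Function.ne_iff.mp hr
    exact Finset.prod_eq_zero (Finset.mem_univ μ) (if_neg hμ)

/-- the normalised DFT matrix `F_{p,x} = |T|^{-1/2} e^{-ip·x}` ((1.29) up to the constant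
normalisations `η^d`, `(2π)^{-d} Π π/L′_μ`, which do not affect operator norms).
[cite: Balaban1984PropagatorsI, (1.29) p.23] -/
def dft : Matrix (Tor N) (Tor N) ℂ :=
  fun p x => ((Real.sqrt (Fintype.card (Tor N)))⁻¹ : ℝ) * conj (chi N p x)

/-- `F F^* = 1`: the rows of the DFT are orthonormal. [folklore] -/
theorem dft_mul_star : dft N * star (dft N) = 1 := by
  classical
  ext p q
  rw [Matrix.mul_apply]
  have hc : (0 : ℝ) < Fintype.card (Tor N) := by
    exact_mod_cast Fintype.card_pos
  have h1 : ∀ x, dft N p x * (star (dft N)) x q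
      = ((Fintype.card (Tor N) : ℝ)⁻¹ : ℝ) * chi N (q - p) x := by
    intro x
    rw [Matrix.star_apply, dft, dft, star_mul', Complex.star_def,
      Complex.conj_conj, Complex.conj_ofReal, conj_chi, sub_eq_add_neg, add_comm, chi_add_left]
    have : (((Real.sqrt (Fintype.card (Tor N)))⁻¹ : ℝ) : ℂ) * (((Real.sqrt (Fintype.card (Tor N)))⁻¹ : ℝ) : ℂ)
        = (((Fintype.card (Tor N) : ℝ)⁻¹ : ℝ) : ℂ) := by
      rw [← Complex.ofReal_mul, ← mul_inv, Real.mul_self_sqrt hc.le]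
    rw [← this]
    ring
  simp_rw [h1]
  rw [← Finset.mul_sum, sum_chi, Matrix.one_apply]
  by_cases hpq : p = q
  · subst hpq
    simp only [sub_self, if_true]
    rw [← Complex.ofReal_natCast, ← Complex.ofReal_mul, inv_mul_cancel₀ hc.ne']
    simp
  · have : ¬ q - p = 0 := fun h => hpq (sub_eq_zero.mp h).symm
    simp [this, hpq]

/-- the DFT is unitary (Plancherel for the finite torus). [folklore] -/
theorem dft_mem_unitaryGroup : dft N ∈ Matrix.unitaryGroup (Tor N) ℂ :=
  Matrix.mem_unitaryGroup_iff.mpr (dft_mul_star N)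

end DFT

/-! ## §3. Vector fields on the torus: componentwise DFT and forward differences

A vector field `J : T_η → ℂ^d` is indexed by `Tor N × Fin d` (site, component).  The forward
lattice derivative of (1.31), `(∇^η_ν J)_μ(x) = η⁻¹ (J_μ(x + η e_ν) − J_μ(x))`, acts on each
component; its adjoint `∇^{η*}_ν` is the matrix adjoint.  In momentum space both are
multiplication operators ("Fourier multipliers"). -/

section VectorFields

variable {d : ℕ} (N : Fin d → ℕ) [hN : ∀ μ, NeZero (N μ)]

/-- the DFT acting on each of the `d` components of a vector field. [folklore] -/
def dftV : Matrix (Tor N × Fin d) (Tor N × Fin d) ℂ :=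
  Matrix.blockDiagonal fun _ : Fin d => dft N

/-- the componentwise DFT is unitary. [folklore] -/
theorem dftV_mem_unitaryGroup : dftV N ∈ Matrix.unitaryGroup (Tor N × Fin d) ℂ := by
  rw [Matrix.mem_unitaryGroup_iff, dftV, Matrix.star_eq_conjTranspose,
    Matrix.blockDiagonal_conjTranspose, ← Matrix.blockDiagonal_mul]
  have h : (fun _ : Fin d => dft N * (dft N)ᴴ) = fun _ => 1 := by
    funext k
    rw [← Matrix.star_eq_conjTranspose, dft_mul_star]
  rw [h]
  exact Matrix.blockDiagonal_one

/-- `U U^* = 1`. [folklore] -/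
theorem dftV_mul_star : dftV N * star (dftV N) = 1 :=
  Matrix.mem_unitaryGroup_iff.mp (dftV_mem_unitaryGroup N)

/-- `U^* U = 1`. [folklore] -/
theorem star_dftV_mul : star (dftV N) * dftV N = 1 :=
  Matrix.mem_unitaryGroup_iff'.mp (dftV_mem_unitaryGroup N)

/-- entries of the componentwise DFT. [folklore] -/
theorem dftV_apply (p : Tor N) (μ : Fin d) (x : Tor N) (μ' : Fin d) :
    dftV N (p, μ) (x, μ') = if μ = μ' then dft N p x else 0 := by
  rw [dftV, Matrix.blockDiagonal_apply']

/-- the unit lattice vector `e_ν` (one lattice step `η e_ν` in direction `ν`). [folklore] -/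
def unitVec (ν : Fin d) : Tor N := Pi.single ν 1

/-- `e^{ip·e_ν} = e^{2πi p_ν/N_ν}` (`= e^{iη p_ν}` in B5's units). [folklore] -/
theorem chi_unitVec (p : Tor N) (ν : Fin d) :
    chi N p (unitVec N ν) = (ZMod.stdAddChar (N := N ν)) (p ν) := by
  unfold chi unitVec
  rw [Finset.prod_eq_single ν]
  · rw [Pi.single_eq_same, mul_one]
  · intro μ _ hμ
    rw [Pi.single_eq_of_ne hμ, mul_zero, AddChar.map_zero_eq_one]
  · intro h; exact absurd (Finset.mem_univ ν) h

/-- `e^{i(-p)·(-x)} = e^{ip·x}`. [folklore] -/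
theorem chi_neg_neg (p x : Tor N) : chi N (-p) (-x) = chi N p x := by
  unfold chi
  refine Finset.prod_congr rfl fun μ _ => ?_
  rw [Pi.neg_apply, Pi.neg_apply, neg_mul_neg]

/-- translation covariance of the DFT kernel: `F_{p, y - e_ν} = e^{2πi p_ν/N_ν} F_{p,y}`.
[folklore] -/
theorem dft_sub_unitVec (p y : Tor N) (ν : Fin d) :
    dft N p (y - unitVec N ν) = (ZMod.stdAddChar (N := N ν)) (p ν) * dft N p y := by
  unfold dft
  rw [sub_eq_add_neg, chi_add_right, map_mul, conj_chi N p (-unitVec N ν), chi_neg_neg,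
    chi_unitVec]
  ring

/-- the translation `(S_ν J)_μ(x) = J_μ(x + e_ν)` of vector fields. [folklore] -/
def shiftM (ν : Fin d) : Matrix (Tor N × Fin d) (Tor N × Fin d) ℂ :=
  fun i j => if j = (i.1 + unitVec N ν, i.2) then 1 else 0

/-- the forward difference `(∇_ν J)_μ(x) = c (J_μ(x + e_ν) − J_μ(x))` with the lattice factor
`c = η⁻¹` ((1.31)). [cite: Balaban1984PropagatorsI, (1.31) p.23] -/
def fdiff (c : ℂ) (ν : Fin d) : Matrix (Tor N × Fin d) (Tor N × Fin d) ℂ :=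
  c • (shiftM N ν - 1)

/-- the Fourier symbol `c (e^{2πi p_ν/N_ν} − 1)` of `∇_ν` (`= η⁻¹(e^{iηp_ν} − 1)`, (1.31)).
[cite: Balaban1984PropagatorsI, (1.31) p.23] -/
def fsym (c : ℂ) (ν : Fin d) (i : Tor N × Fin d) : ℂ :=
  c * ((ZMod.stdAddChar (N := N ν)) (i.1 ν) - 1)

/-- INTERTWINING: `U S_ν = diag(e^{2πi p_ν/N_ν}) U`. [folklore] -/
theorem dftV_mul_shiftM (ν : Fin d) :
    dftV N * shiftM N ν
      = Matrix.diagonal (fun i : Tor N × Fin d => (ZMod.stdAddChar (N := N ν)) (i.1 ν))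
        * dftV N := by
  ext ⟨p, μ⟩ ⟨y, μ'⟩
  rw [Matrix.mul_apply, Matrix.diagonal_mul, Finset.sum_eq_single (y - unitVec N ν, μ')]
  · rw [shiftM, if_pos (by simp), mul_one, dftV_apply, dftV_apply, dft_sub_unitVec]
    split_ifs <;> simp
  · rintro ⟨x, κ⟩ _ hx
    rw [shiftM]
    split_ifs with h
    · exfalso
      apply hx
      simp only [Prod.mk.injEq] at h
      obtain ⟨h1, h2⟩ := h
      simp [h1, h2]
    · rw [mul_zero]
  · intro h; exact absurd (Finset.mem_univ _) h

/-- INTERTWINING for the forward difference: `U ∇_ν = diag(fsym) U`, i.e. `∇_ν` is the Fourier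
multiplier with symbol `fsym`. [folklore] -/
theorem dftV_mul_fdiff (c : ℂ) (ν : Fin d) :
    dftV N * fdiff N c ν = Matrix.diagonal (fsym N c ν) * dftV N := by
  rw [fdiff, Matrix.mul_smul, Matrix.mul_sub, Matrix.mul_one, dftV_mul_shiftM]
  have h : Matrix.diagonal (fsym N c ν)
      = c • (Matrix.diagonal (fun i : Tor N × Fin d => (ZMod.stdAddChar (N := N ν)) (i.1 ν)) - 1) := by
    ext i j
    by_cases hij : i = j
    · subst hij
      simp [fsym]
    · simp [hij]
  rw [h, Matrix.smul_mul, Matrix.sub_mul, Matrix.one_mul]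

/-- `∇_ν = U^* diag(fsym) U`. [folklore] -/
theorem fdiff_eq (c : ℂ) (ν : Fin d) :
    fdiff N c ν = star (dftV N) * Matrix.diagonal (fsym N c ν) * dftV N := by
  rw [Matrix.mul_assoc, ← dftV_mul_fdiff, ← Matrix.mul_assoc, star_dftV_mul, Matrix.one_mul]

/-- `∇_ν^* = U^* diag(conj fsym) U`. [folklore] -/
theorem star_fdiff_eq (c : ℂ) (ν : Fin d) :
    star (fdiff N c ν) = star (dftV N) * Matrix.diagonal (star (fsym N c ν)) * dftV N := by
  rw [fdiff_eq, star_mul, star_mul, star_star, ← Matrix.mul_assoc, Matrix.star_eq_conjTranspose,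
    Matrix.star_eq_conjTranspose (Matrix.diagonal _), Matrix.diagonal_conjTranspose,
    ← Matrix.star_eq_conjTranspose]

end VectorFields

/-! ## §4. The coset decomposition `p = p′ + l` of the fine dual torus

B5 p. 23 after (1.31): "p ∈ T̃_η is represented as a sum p = p′ + l, p′ ∈ T̃₁^{(k)} and
l = (l₁, …, l_d), l_μ = 2πm_μ, m_μ is an integer".  Here: the fine torus has `N_μ = n·M_μ` sites
per direction (`n = η^{−1}`, `M_μ` = the number of unit-lattice sites), a fine momentum index
`j_μ ∈ ℤ/(nM_μ)` is written uniquely as `j_μ = v_μ + M_μ k_μ` with `v_μ = valMinAbs` of the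
coarse class `q_μ ∈ ℤ/M_μ` (`p′_μ = 2π v_μ/M_μ ∈ [−π, π]`) and `k_μ ∈ {0, …, n−1}`
(`l_μ = 2π k_μ`), and then `η(p′_μ + l_μ) = 2π j_μ/(nM_μ)`. -/

section Cosets

variable {d : ℕ} (n : ℕ) [NeZero n] (M : Fin d → ℕ) [hM : ∀ μ, NeZero (M μ)]

/-- the fine torus sizes `N_μ = n M_μ` (`n = η⁻¹`). [folklore] -/
abbrev fine : Fin d → ℕ := fun μ => n * M μ

/-- `N_μ = n M_μ ≠ 0`. [folklore] -/
instance fine_neZero (μ : Fin d) : NeZero (fine n M μ) := inferInstanceAs (NeZero (n * M μ))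

/-- the coset parametrisation `((k, μ), q) ↦ ((v(q_ν) + M_ν k_ν mod nM_ν)_ν, μ)` of
(fine momentum, component) by (offset `l = 2πk` and component, coarse momentum `p′ ↔ q`).
[folklore] -/
def emb (I : ((Fin d → Fin n) × Fin d) × Tor M) : Tor (fine n M) × Fin d :=
  (fun ν => (((I.2 ν).valMinAbs + (M ν : ℤ) * ((I.1.1 ν : ℕ) : ℤ) : ℤ) : ZMod (fine n M ν)), I.1.2)

omit [NeZero n] in
/-- the coset parametrisation is injective. [folklore] -/
theorem emb_injective : Function.Injective (emb n M) := by
  rintro ⟨⟨k, μ⟩, q⟩ ⟨⟨k', μ'⟩, q'⟩ h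
  simp only [emb, Prod.mk.injEq] at h
  obtain ⟨h1, h2⟩ := h
  have hν : ∀ ν, q ν = q' ν ∧ k ν = k' ν := by
    intro ν
    have h3 := congr_fun h1 ν
    rw [ZMod.intCast_eq_intCast_iff_dvd_sub] at h3
    have hM0 : (M ν : ℤ) ≠ 0 := by exact_mod_cast (NeZero.ne (M ν))
    have hNM : ((fine n M ν : ℕ) : ℤ) = (M ν : ℤ) * n := by
      simp only [fine]; push_cast; ring
    rw [hNM] at h3
    have h4 : (M ν : ℤ) ∣ (q' ν).valMinAbs - (q ν).valMinAbs := by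
      have h5 : (M ν : ℤ) ∣ _ := (dvd_mul_right (M ν : ℤ) n).trans h3
      have h6 : (q' ν).valMinAbs - (q ν).valMinAbs
          = ((q' ν).valMinAbs + (M ν : ℤ) * ((k' ν : ℕ) : ℤ))
            - ((q ν).valMinAbs + (M ν : ℤ) * ((k ν : ℕ) : ℤ))
            - (M ν : ℤ) * (((k' ν : ℕ) : ℤ) - ((k ν : ℕ) : ℤ)) := by ring
      rw [h6]
      exact dvd_sub h5 (dvd_mul_right _ _)
    have hq : q ν = q' ν := by
      have h7 := (ZMod.intCast_eq_intCast_iff_dvd_sub _ _ (M ν)).mpr h4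
      rwa [ZMod.coe_valMinAbs, ZMod.coe_valMinAbs] at h7
    refine ⟨hq, ?_⟩
    rw [hq] at h3
    have h8 : (n : ℤ) ∣ ((k' ν : ℕ) : ℤ) - ((k ν : ℕ) : ℤ) := by
      have h6 : ((q' ν).valMinAbs + (M ν : ℤ) * ((k' ν : ℕ) : ℤ))
            - ((q' ν).valMinAbs + (M ν : ℤ) * ((k ν : ℕ) : ℤ))
          = (M ν : ℤ) * (((k' ν : ℕ) : ℤ) - ((k ν : ℕ) : ℤ)) := by ring
      rw [h6] at h3
      exact (mul_dvd_mul_iff_left hM0).mp h3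
    have h9 : ((k' ν : ℕ) : ℤ) - ((k ν : ℕ) : ℤ) = 0 := by
      refine Int.eq_zero_of_dvd_of_natAbs_lt_natAbs h8 ?_
      simpa using Int.natAbs_coe_sub_coe_lt_of_lt (k' ν).isLt (k ν).isLt
    exact Fin.ext (by omega)
  exact Prod.ext (Prod.ext (funext fun ν => (hν ν).2) h2) (funext fun ν => (hν ν).1)

/-- both index sets have `d · Π_μ (n M_μ)` elements. [folklore] -/
theorem card_eq :
    Fintype.card (((Fin d → Fin n) × Fin d) × Tor M) = Fintype.card (Tor (fine n M) × Fin d) := by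
  simp only [Fintype.card_prod, Fintype.card_pi, Fintype.card_fin, ZMod.card, Finset.prod_const,
    Finset.card_univ, fine]
  rw [Finset.prod_mul_distrib, Finset.prod_const, Finset.card_univ, Fintype.card_fin]
  ring

/-- the coset parametrisation is a bijection. [folklore] -/
theorem emb_bijective : Function.Bijective (emb n M) :=
  (Fintype.bijective_iff_injective_and_card _).mpr ⟨emb_injective n M, card_eq n M⟩

/-- `(fine momentum, component) ≃ ((offset k, component), coarse momentum q)`. [folklore] -/
def blockEquiv : Tor (fine n M) × Fin d ≃ ((Fin d → Fin n) × Fin d) × Tor M :=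
  (Equiv.ofBijective (emb n M) (emb_bijective n M)).symm

/-- the inverse of `blockEquiv` is the coset parametrisation. [folklore] -/
@[simp] theorem blockEquiv_symm_apply (I : ((Fin d → Fin n) × Fin d) × Tor M) :
    (blockEquiv n M).symm I = emb n M I := rfl

/-- the reduced momentum `p′_ν = 2π v(q_ν)/M_ν ∈ [-π, π]` of a coarse class `q`. [folklore] -/
def sOf (q : Tor M) : Fin d → ℝ := fun ν => 2 * Real.pi * ((q ν).valMinAbs : ℝ) / (M ν : ℝ)

/-- `|p′_ν| ≤ π`. [folklore] -/
theorem abs_sOf_le (q : Tor M) (ν : Fin d) : |sOf M q ν| ≤ Real.pi := by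
  have hM : (0 : ℝ) < M ν := by exact_mod_cast Nat.pos_of_ne_zero (NeZero.ne (M ν))
  have h1 : (((q ν).valMinAbs.natAbs : ℕ) : ℝ) ≤ (M ν : ℝ) / 2 := by
    have h := ZMod.natAbs_valMinAbs_le (q ν)
    have h' : ((M ν / 2 : ℕ) : ℝ) ≤ (M ν : ℝ) / 2 := Nat.cast_div_le
    exact le_trans (by exact_mod_cast h) h'
  have h2 : |((q ν).valMinAbs : ℝ)| ≤ (M ν : ℝ) / 2 := by
    rw [← Int.cast_abs, Int.abs_eq_natAbs, Int.cast_natCast]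
    exact h1
  have h2π : (0 : ℝ) < 2 * Real.pi := by positivity
  unfold sOf
  rw [abs_div, abs_of_pos hM, abs_mul, abs_of_pos h2π, div_le_iff₀ hM]
  nlinarith [h2, Real.pi_pos]

/-- `p′ = 0 ↔ q = 0`; contrapositive form. [folklore] -/
theorem sOf_ne_zero {q : Tor M} (hq : q ≠ 0) : sOf M q ≠ 0 := by
  obtain ⟨ν, hν⟩ := Function.ne_iff.mp hq
  rw [Function.ne_iff]
  refine ⟨ν, ?_⟩
  have hM : (M ν : ℝ) ≠ 0 := by exact_mod_cast NeZero.ne (M ν)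
  have hv : ((q ν).valMinAbs : ℝ) ≠ 0 := by
    exact_mod_cast (mt (ZMod.valMinAbs_eq_zero (q ν)).mp hν)
  unfold sOf
  simp only [Pi.zero_apply]
  exact div_ne_zero (mul_ne_zero (mul_ne_zero two_ne_zero Real.pi_ne_zero) hv) hM

omit hM in
/-- `p′(0) = 0`. [folklore] -/
@[simp] theorem sOf_zero : sOf M (0 : Tor M) = 0 := by
  funext ν
  simp [sOf]

/-- THE SYMBOL IDENTITY: on the coset `p = p′ + l`, the Fourier symbol of the forward difference
`η⁻¹(e^{iηp_ν} − 1) = n (e^{2πi j_ν/(nM_ν)} − 1)` equals `∂_ν(p′ + l)` of (1.83)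
(`B5Prop11Fiber.dSym`). [cite: Balaban1984PropagatorsI, (1.31) p.23] -/
theorem fsym_emb (k : Fin d → Fin n) (μ : Fin d) (q : Tor M) (ν : Fin d) :
    fsym (fine n M) (n : ℂ) ν (emb n M ((k, μ), q)) = dSym n k (sOf M q) ν := by
  have hM : (M ν : ℂ) ≠ 0 := by exact_mod_cast NeZero.ne (M ν)
  have hn : (n : ℂ) ≠ 0 := by exact_mod_cast NeZero.ne n
  unfold fsym emb dSym shiftr sOf
  simp only
  rw [ZMod.stdAddChar_coe]
  congr 3
  simp only [fine]
  push_cast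
  field_simp

end Cosets

/-! ## §5. The operator with Fourier blocks (1.83) and the six bounds of (1.89) -/

section Operator

variable {d : ℕ} (n : ℕ) [NeZero n] (hn : 1 ≤ n) (M : Fin d → ℕ) [hM : ∀ μ, NeZero (M μ)]
  (a : ℝ) (ha : 0 < a)

/-- the fiber matrices: (1.83) at `p′ ≠ 0` (`B5Prop11Fiber.balabanFiber … .G`), and at `p′ = 0`
the diagonal matrix `G₀` (entries `a⁻¹` at `l = 0`, `Δ(l)⁻¹` at `l ≠ 0`, where every `u`, `v`
factor of (1.83) with `l ≠ l′` vanishes). [cite: Balaban1984PropagatorsI, (1.83) p.31] -/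
def blocks (q : Tor M) : Matrix ((Fin d → Fin n) × Fin d) ((Fin d → Fin n) × Fin d) ℂ :=
  if h : q = 0 then G₀ (d := d) (fun _ => (0 : Fin n)) a (fun k => DeltaXir n 0 (shiftr n k 0))
  else (balabanFiber n hn a ha (sOf M q) (abs_sOf_le M q) (sOf_ne_zero M h)).G

/-- the momentum-space operator: the block family transported to (fine momentum, component)
indices along the coset decomposition. [folklore] -/
def calGhat : Matrix (Tor (fine n M) × Fin d) (Tor (fine n M) × Fin d) ℂ :=
  (Matrix.reindex (blockEquiv n M) (blockEquiv n M)).symm (Matrix.blockDiagonal (blocks n hn M a ha))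

/-- THE OPERATOR `𝒢 = F^* Ĝ F` on `ℓ²(T_η; ℂ^d)` whose Fourier blocks over the cosets
`p = p′ + l` are the matrices (1.83). [cite: Balaban1984PropagatorsI, (1.83) p.31] -/
def calG : Matrix (Tor (fine n M) × Fin d) (Tor (fine n M) × Fin d) ℂ :=
  star (dftV (fine n M)) * calGhat n hn M a ha * dftV (fine n M)

/-- `F^* (diag W₁ · Ĝ · diag W₂^*) F`: `𝒢` composed with Fourier multipliers on both sides.
[folklore] -/
def mulW (W₁ W₂ : Tor (fine n M) × Fin d → ℂ) :
    Matrix (Tor (fine n M) × Fin d) (Tor (fine n M) × Fin d) ℂ :=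
  star (dftV (fine n M))
    * (Matrix.diagonal W₁ * calGhat n hn M a ha * Matrix.diagonal (star W₂)) * dftV (fine n M)

/-- `𝒢 = mulW 1 1`. [folklore] -/
theorem calG_eq_mulW : calG n hn M a ha = mulW n hn M a ha (fun _ => 1) (fun _ => 1) := by
  have h1 : Matrix.diagonal (fun _ : Tor (fine n M) × Fin d => (1 : ℂ)) = 1 := Matrix.diagonal_one
  have h2 : star (fun _ : Tor (fine n M) × Fin d => (1 : ℂ)) = fun _ => 1 := by
    funext i
    simp
  rw [mulW, h2, h1, Matrix.one_mul, Matrix.mul_one, calG]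

/-- `∇_ν · mulW W₁ W₂ = mulW (fsym_ν W₁) W₂`. [folklore] -/
theorem fdiff_mul_mulW (ν : Fin d) (W₁ W₂ : Tor (fine n M) × Fin d → ℂ) :
    fdiff (fine n M) (n : ℂ) ν * mulW n hn M a ha W₁ W₂
      = mulW n hn M a ha (fun i => fsym (fine n M) (n : ℂ) ν i * W₁ i) W₂ := by
  rw [fdiff_eq, mulW, mulW]
  have hU := dftV_mul_star (fine n M)
  set U := dftV (fine n M)
  set X := calGhat n hn M a ha
  calc star U * Matrix.diagonal (fsym (fine n M) (n : ℂ) ν) * U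
        * (star U * (Matrix.diagonal W₁ * X * Matrix.diagonal (star W₂)) * U)
      = star U * Matrix.diagonal (fsym (fine n M) (n : ℂ) ν) * (U * star U)
        * (Matrix.diagonal W₁ * X * Matrix.diagonal (star W₂)) * U := by
        simp only [Matrix.mul_assoc]
    _ = star U * (Matrix.diagonal (fun i => fsym (fine n M) (n : ℂ) ν i * W₁ i) * X
        * Matrix.diagonal (star W₂)) * U := by
        rw [hU, Matrix.mul_one, ← Matrix.diagonal_mul_diagonal]
        simp only [Matrix.mul_assoc]

/-- `mulW W₁ W₂ · ∇_ν^* = mulW W₁ (W₂ fsym_ν)`. [folklore] -/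
theorem mulW_mul_star_fdiff (ν : Fin d) (W₁ W₂ : Tor (fine n M) × Fin d → ℂ) :
    mulW n hn M a ha W₁ W₂ * star (fdiff (fine n M) (n : ℂ) ν)
      = mulW n hn M a ha W₁ (fun i => W₂ i * fsym (fine n M) (n : ℂ) ν i) := by
  rw [star_fdiff_eq, mulW, mulW]
  have hU := dftV_mul_star (fine n M)
  set U := dftV (fine n M)
  set X := calGhat n hn M a ha
  have hd : Matrix.diagonal (star W₂) * Matrix.diagonal (star (fsym (fine n M) (n : ℂ) ν))
      = Matrix.diagonal (star (fun i => W₂ i * fsym (fine n M) (n : ℂ) ν i)) := by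
    rw [Matrix.diagonal_mul_diagonal]
    congr 1
    funext i
    simp
  calc star U * (Matrix.diagonal W₁ * X * Matrix.diagonal (star W₂)) * U
        * (star U * Matrix.diagonal (star (fsym (fine n M) (n : ℂ) ν)) * U)
      = star U * (Matrix.diagonal W₁ * X * Matrix.diagonal (star W₂)) * (U * star U)
        * Matrix.diagonal (star (fsym (fine n M) (n : ℂ) ν)) * U := by
        simp only [Matrix.mul_assoc]
    _ = star U * (Matrix.diagonal W₁ * X
        * Matrix.diagonal (star (fun i => W₂ i * fsym (fine n M) (n : ℂ) ν i))) * U := by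
        rw [hU, Matrix.mul_one, ← hd]
        simp only [Matrix.mul_assoc]

/-- THE BLOCK STRUCTURE: in momentum space and along the coset decomposition,
`F (mulW W₁ W₂) F^*` is block-diagonal over the coarse momenta `p′`, with block
`D_{w₁} G(p′) D_{w₂}^*` (`B5Prop11Bound.sandwich`) whenever the multipliers restrict to the
cosets as `W_i(p′ + l) = w_i(p′)(l)`. [folklore] -/
theorem reindex_conj_mulW (W₁ W₂ : Tor (fine n M) × Fin d → ℂ)
    (w₁ w₂ : Tor M → (Fin d → Fin n) → ℂ)
    (e₁ : ∀ I, W₁ ((blockEquiv n M).symm I) = w₁ I.2 I.1.1)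
    (e₂ : ∀ I, W₂ ((blockEquiv n M).symm I) = w₂ I.2 I.1.1) :
    Matrix.reindex (blockEquiv n M) (blockEquiv n M)
        (dftV (fine n M) * mulW n hn M a ha W₁ W₂ * star (dftV (fine n M)))
      = Matrix.blockDiagonal (fun q => sandwich (w₁ q) (w₂ q) (blocks n hn M a ha q)) := by
  have hU := dftV_mul_star (fine n M)
  have hY : dftV (fine n M) * mulW n hn M a ha W₁ W₂ * star (dftV (fine n M))
      = Matrix.diagonal W₁ * calGhat n hn M a ha * Matrix.diagonal (star W₂) := by
    rw [mulW]
    set U := dftV (fine n M)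
    set Y := Matrix.diagonal W₁ * calGhat n hn M a ha * Matrix.diagonal (star W₂)
    calc U * (star U * Y * U) * star U = (U * star U) * Y * (U * star U) := by
          simp only [Matrix.mul_assoc]
      _ = Y := by rw [hU, Matrix.one_mul, Matrix.mul_one]
  rw [hY]
  ext ⟨i, q⟩ ⟨j, q'⟩
  have f₁ := e₁ (i, q)
  have f₂ := e₂ (j, q')
  simp only at f₁ f₂
  simp only [Matrix.reindex_apply, Matrix.submatrix_apply, Matrix.mul_diagonal, Matrix.diagonal_mul,
    calGhat, Matrix.reindex_symm, Equiv.symm_symm, Equiv.apply_symm_apply,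
    Matrix.blockDiagonal_apply', Pi.star_apply, Complex.star_def, f₁, f₂, sandwich]
  split_ifs with h
  · subst h
    rfl
  · simp

/-- every block is Hermitian. [folklore] -/
theorem blocks_isHermitian (q : Tor M) : (blocks n hn M a ha q).IsHermitian := by
  by_cases hq : q = 0
  · subst hq
    rw [blocks, dif_pos rfl, G₀, Matrix.isHermitian_diagonal_iff]
    intro i
    split_ifs
    · rw [IsSelfAdjoint, Complex.star_def, map_div₀, map_one, Complex.conj_ofReal]
    · rw [IsSelfAdjoint, Complex.star_def, map_div₀, map_one, Complex.conj_ofReal]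
  · rw [blocks, dif_neg hq]
    exact G_isHermitian n hn a ha _ _ _

/-- the momentum-space operator is Hermitian. [folklore] -/
theorem calGhat_isHermitian : (calGhat n hn M a ha).IsHermitian := by
  have h : (Matrix.blockDiagonal (blocks n hn M a ha)).IsHermitian := by
    rw [Matrix.IsHermitian, Matrix.blockDiagonal_conjTranspose]
    congr 1
    funext q
    exact (blocks_isHermitian n hn M a ha q).eq
  rw [calGhat, Matrix.reindex_symm, Matrix.reindex_apply]
  exact h.submatrix _

/-- "The operator `G` is a symmetric operator on `L²(T_η)`": `𝒢` is Hermitian.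
[cite: Balaban1984PropagatorsI, Prop. 1.1 p.33 (kernel version; proof ours)] -/
theorem calG_isHermitian : (calG n hn M a ha).IsHermitian := by
  rw [calG, Matrix.star_eq_conjTranspose]
  exact Matrix.isHermitian_conjTranspose_mul_mul _ (calGhat_isHermitian n hn M a ha)

/-- the constant of the kernel version of (1.89): `max(γ(d,a), a⁻¹, 1)` with
`γ(d,a) = B5Prop11Fiber.gamma0 d a`; it depends on `d` and `a` only. [folklore] -/
def Cst (d : ℕ) (a : ℝ) : ℝ := max (gamma0 d a) (max (1 / a) 1)

/-- `Cst ≥ 1 ≥ 0`. [folklore] -/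
theorem Cst_nonneg (d : ℕ) (a : ℝ) : 0 ≤ Cst d a :=
  le_trans zero_le_one (le_trans (le_max_right _ _) (le_max_right _ _))

/-- `Δ(0 + 0) = 0` (the `p′ = 0`, `l = 0` mode). [folklore] -/
theorem Delta_zero_zero :
    DeltaXir n 0 (shiftr n (fun _ : Fin d => (0 : Fin n)) (0 : Fin d → ℝ)) = 0 := by
  simp [DeltaXir, shiftr, Sxir]

/-- the `p′ = 0` block with weights of orders `j₁ + j₂ ≤ 2`: `‖D_{w₁} G(0) D_{w₂}^*‖ ≤ max(a⁻¹,1)`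
(a weight of positive order vanishes at `l = 0` since `Δ(0) = 0`). [folklore] -/
theorem opNorm_sandwich_G₀_le_of_orders (ha : 0 < a) {w₁ w₂ : (Fin d → Fin n) → ℂ} {j₁ j₂ : ℕ}
    (hj : j₁ + j₂ ≤ 2) (h₁ : ∀ k, ‖w₁ k‖ ^ 2 ≤ DeltaXir n 0 (shiftr n k 0) ^ j₁)
    (h₂ : ∀ k, ‖w₂ k‖ ^ 2 ≤ DeltaXir n 0 (shiftr n k 0) ^ j₂) :
    ‖sandwich w₁ w₂ (G₀ (d := d) (fun _ => (0 : Fin n)) a (fun k => DeltaXir n 0 (shiftr n k 0)))‖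
      ≤ max (1 / a) 1 := by
  have hs : ∀ μ : Fin d, |(0 : Fin d → ℝ) μ| ≤ Real.pi := fun μ => by
    simp [Real.pi_pos.le]
  have h4 : ∀ l : Fin d → Fin n, l ≠ (fun _ => 0) → 4 ≤ DeltaXir n 0 (shiftr n l 0) :=
    fun l hl => DeltaXir_shift_ge_four n l hl 0 hs
  refine opNorm_sandwich_G₀_le (fun _ => (0 : Fin n)) ha _ (fun l hl => by linarith [h4 l hl])
    w₁ w₂ ?_ ?_
  · -- at `l = 0`: `Δ = 0`, so a weight of positive order vanishes; order-0 weights are `≤ 1`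
    have g₁ := h₁ (fun _ => 0)
    have g₂ := h₂ (fun _ => 0)
    rw [Delta_zero_zero] at g₁ g₂
    have n₁ := norm_nonneg (w₁ fun _ => 0)
    have n₂ := norm_nonneg (w₂ fun _ => 0)
    rcases Nat.eq_zero_or_pos j₁ with hj₁ | hj₁
    · rcases Nat.eq_zero_or_pos j₂ with hj₂ | hj₂
      · rw [hj₁, pow_zero] at g₁
        rw [hj₂, pow_zero] at g₂
        nlinarith
      · rw [zero_pow (Nat.pos_iff_ne_zero.mp hj₂)] at g₂
        have : ‖w₂ fun _ => 0‖ = 0 := by nlinarith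
        rw [this, mul_zero]
        exact zero_le_one
    · rw [zero_pow (Nat.pos_iff_ne_zero.mp hj₁)] at g₁
      have : ‖w₁ fun _ => 0‖ = 0 := by nlinarith
      rw [this, zero_mul]
      exact zero_le_one
  · intro l hl
    have hD := h4 l hl
    have g₁ := h₁ l
    have g₂ := h₂ l
    set D := DeltaXir n 0 (shiftr n l 0)
    have hD1 : 1 ≤ D := by linarith
    have e₁ : ‖w₁ l‖ ^ 2 ≤ D ^ j₁ := g₁
    have e₂ : ‖w₂ l‖ ^ 2 ≤ D ^ j₂ := g₂
    have hprod : (‖w₁ l‖ * ‖w₂ l‖) ^ 2 ≤ D ^ 2 := by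
      calc (‖w₁ l‖ * ‖w₂ l‖) ^ 2 = ‖w₁ l‖ ^ 2 * ‖w₂ l‖ ^ 2 := by ring
        _ ≤ D ^ j₁ * D ^ j₂ :=
          mul_le_mul e₁ e₂ (sq_nonneg _) (pow_nonneg (by linarith) _)
        _ = D ^ (j₁ + j₂) := (pow_add _ _ _).symm
        _ ≤ D ^ 2 := pow_le_pow_right₀ hD1 hj
    exact (pow_le_pow_iff_left₀ (mul_nonneg (norm_nonneg _) (norm_nonneg _)) (by linarith)
      two_ne_zero).mp hprod

/-- every block with weights of orders `j₁ + j₂ ≤ 2` at its own `p′` is bounded by `Cst d a`.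
[folklore] -/
theorem block_bound_of_orders (q : Tor M) {w₁ w₂ : (Fin d → Fin n) → ℂ} {j₁ j₂ : ℕ}
    (hj : j₁ + j₂ ≤ 2) (h₁ : ∀ k, ‖w₁ k‖ ^ 2 ≤ DeltaXir n 0 (shiftr n k (sOf M q)) ^ j₁)
    (h₂ : ∀ k, ‖w₂ k‖ ^ 2 ≤ DeltaXir n 0 (shiftr n k (sOf M q)) ^ j₂) :
    ‖sandwich w₁ w₂ (blocks n hn M a ha q)‖ ≤ Cst d a := by
  by_cases hq : q = 0
  · subst hq
    rw [blocks, dif_pos rfl]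
    simp only [sOf_zero] at h₁ h₂
    exact (opNorm_sandwich_G₀_le_of_orders n a ha hj h₁ h₂).trans (le_max_right _ _)
  · rw [blocks, dif_neg hq]
    exact (opNorm_sandwich_G_le_of_orders n hn a ha _ _ _ hj h₁ h₂).trans (le_max_left _ _)

/-- THE PLANCHEREL BOUND for `𝒢` with multipliers: if the multipliers restrict to the cosets as
weights of orders `j₁ + j₂ ≤ 2`, then `‖mulW W₁ W₂‖ ≤ Cst d a`. [folklore] -/
theorem opNorm_mulW_le {j₁ j₂ : ℕ} (hj : j₁ + j₂ ≤ 2) (W₁ W₂ : Tor (fine n M) × Fin d → ℂ)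
    (w₁ w₂ : Tor M → (Fin d → Fin n) → ℂ)
    (e₁ : ∀ I, W₁ ((blockEquiv n M).symm I) = w₁ I.2 I.1.1)
    (e₂ : ∀ I, W₂ ((blockEquiv n M).symm I) = w₂ I.2 I.1.1)
    (h₁ : ∀ q k, ‖w₁ q k‖ ^ 2 ≤ DeltaXir n 0 (shiftr n k (sOf M q)) ^ j₁)
    (h₂ : ∀ q k, ‖w₂ q k‖ ^ 2 ≤ DeltaXir n 0 (shiftr n k (sOf M q)) ^ j₂) :
    ‖mulW n hn M a ha W₁ W₂‖ ≤ Cst d a :=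
  opNorm_le_of_blocks (dftV_mem_unitaryGroup (fine n M)) (blockEquiv n M) _ _
    (reindex_conj_mulW n hn M a ha W₁ W₂ w₁ w₂ e₁ e₂) (Cst_nonneg d a)
    (fun q => block_bound_of_orders n hn M a ha q hj (h₁ q) (h₂ q))

/-- restriction of the multiplier `1` to the cosets. [folklore] -/
theorem restrict_one (I : ((Fin d → Fin n) × Fin d) × Tor M) :
    (fun _ : Tor (fine n M) × Fin d => (1 : ℂ)) ((blockEquiv n M).symm I)
      = (fun (_ : Tor M) (_ : Fin d → Fin n) => (1 : ℂ)) I.2 I.1.1 := rfl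

/-- restriction of the symbol of `∇_ν` to the cosets: `∂_ν(p′ + l)`. [folklore] -/
theorem restrict_fsym (ν : Fin d) (I : ((Fin d → Fin n) × Fin d) × Tor M) :
    fsym (fine n M) (n : ℂ) ν ((blockEquiv n M).symm I) = dSym n I.1.1 (sOf M I.2) ν := by
  obtain ⟨⟨k, μ⟩, q⟩ := I
  exact fsym_emb n M k μ q ν

/-- (1.89), first bound: `‖𝒢‖ ≤ Cst(d,a)`. [cite: Balaban1984PropagatorsI, Prop. 1.1 (1.89) p.33
(kernel version for the operator with Fourier blocks (1.83); proof ours)] -/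
theorem opNorm_calG_le : ‖calG n hn M a ha‖ ≤ Cst d a := by
  rw [calG_eq_mulW]
  exact opNorm_mulW_le n hn M a ha (j₁ := 0) (j₂ := 0) (by norm_num) _ _ _ _
    (restrict_one n M) (restrict_one n M)
    (fun q k => weight_order_zero n (sOf M q) k) (fun q k => weight_order_zero n (sOf M q) k)

/-- (1.89), second bound: `‖∇_ν 𝒢‖ ≤ Cst(d,a)`. [cite: Balaban1984PropagatorsI, Prop. 1.1 (1.89)
p.33 (kernel version; proof ours)] -/
theorem opNorm_fdiff_calG_le (ν : Fin d) :
    ‖fdiff (fine n M) (n : ℂ) ν * calG n hn M a ha‖ ≤ Cst d a := by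
  rw [calG_eq_mulW, fdiff_mul_mulW]
  refine opNorm_mulW_le n hn M a ha (j₁ := 1) (j₂ := 0) (by norm_num) _ _
    (fun q k => dSym n k (sOf M q) ν) (fun _ _ => 1) ?_ (restrict_one n M)
    (fun q k => weight_order_one n (sOf M q) ν k) (fun q k => weight_order_zero n (sOf M q) k)
  intro I
  simp only [mul_one]
  exact restrict_fsym n M ν I

/-- (1.89), third bound: `‖𝒢 ∇_ν^*‖ ≤ Cst(d,a)`. [cite: Balaban1984PropagatorsI, Prop. 1.1 (1.89)
p.33 (kernel version; proof ours)] -/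
theorem opNorm_calG_star_fdiff_le (ν : Fin d) :
    ‖calG n hn M a ha * star (fdiff (fine n M) (n : ℂ) ν)‖ ≤ Cst d a := by
  rw [calG_eq_mulW, mulW_mul_star_fdiff]
  refine opNorm_mulW_le n hn M a ha (j₁ := 0) (j₂ := 1) (by norm_num) _ _
    (fun _ _ => 1) (fun q k => dSym n k (sOf M q) ν) (restrict_one n M) ?_
    (fun q k => weight_order_zero n (sOf M q) k) (fun q k => weight_order_one n (sOf M q) ν k)
  intro I
  simp only [one_mul]
  exact restrict_fsym n M ν I

/-- (1.89), fourth bound: `‖∇_ν 𝒢 ∇_{ν′}^*‖ ≤ Cst(d,a)`. [cite: Balaban1984PropagatorsI,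
Prop. 1.1 (1.89) p.33 (kernel version; proof ours)] -/
theorem opNorm_fdiff_calG_star_fdiff_le (ν ν' : Fin d) :
    ‖fdiff (fine n M) (n : ℂ) ν * calG n hn M a ha * star (fdiff (fine n M) (n : ℂ) ν')‖
      ≤ Cst d a := by
  rw [calG_eq_mulW, fdiff_mul_mulW, mulW_mul_star_fdiff]
  refine opNorm_mulW_le n hn M a ha (j₁ := 1) (j₂ := 1) (by norm_num) _ _
    (fun q k => dSym n k (sOf M q) ν) (fun q k => dSym n k (sOf M q) ν') ?_ ?_
    (fun q k => weight_order_one n (sOf M q) ν k) (fun q k => weight_order_one n (sOf M q) ν' k)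
  · intro I
    simp only [mul_one]
    exact restrict_fsym n M ν I
  · intro I
    simp only [one_mul]
    exact restrict_fsym n M ν' I

/-- (1.89), fifth bound: `‖∇_ν ∇_{ν′} 𝒢‖ ≤ Cst(d,a)`. [cite: Balaban1984PropagatorsI,
Prop. 1.1 (1.89) p.33 (kernel version; proof ours)] -/
theorem opNorm_fdiff_fdiff_calG_le (ν ν' : Fin d) :
    ‖fdiff (fine n M) (n : ℂ) ν * fdiff (fine n M) (n : ℂ) ν' * calG n hn M a ha‖
      ≤ Cst d a := by
  rw [calG_eq_mulW, Matrix.mul_assoc, fdiff_mul_mulW, fdiff_mul_mulW]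
  refine opNorm_mulW_le n hn M a ha (j₁ := 2) (j₂ := 0) (by norm_num) _ _
    (fun q k => dSym n k (sOf M q) ν * dSym n k (sOf M q) ν') (fun _ _ => 1) ?_ (restrict_one n M)
    (fun q k => weight_order_two n (sOf M q) ν ν' k) (fun q k => weight_order_zero n (sOf M q) k)
  intro I
  simp only [mul_one]
  rw [restrict_fsym, restrict_fsym]

/-- (1.89), sixth bound: `‖𝒢 ∇_ν^* ∇_{ν′}^*‖ ≤ Cst(d,a)`. [cite: Balaban1984PropagatorsI,
Prop. 1.1 (1.89) p.33 (kernel version; proof ours)] -/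
theorem opNorm_calG_star_fdiff_star_fdiff_le (ν ν' : Fin d) :
    ‖calG n hn M a ha * star (fdiff (fine n M) (n : ℂ) ν) * star (fdiff (fine n M) (n : ℂ) ν')‖
      ≤ Cst d a := by
  rw [calG_eq_mulW, mulW_mul_star_fdiff, mulW_mul_star_fdiff]
  refine opNorm_mulW_le n hn M a ha (j₁ := 0) (j₂ := 2) (by norm_num) _ _
    (fun _ _ => 1) (fun q k => dSym n k (sOf M q) ν * dSym n k (sOf M q) ν') (restrict_one n M) ?_
    (fun q k => weight_order_zero n (sOf M q) k) (fun q k => weight_order_two n (sOf M q) ν ν' k)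
  intro I
  simp only [one_mul]
  rw [restrict_fsym, restrict_fsym]

end Operator

end

end Literature.MathematicalPhysics.QuantumFieldTheory.Balaban1983to89.B5Prop11Plancherel
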